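import Mathlib.CategoryTheory.Limits.FullSubcategory
import Literature.AnabelianGeometry.Anabelioids.ImageGaloisProofs
import Literature.AnabelianGeometry.Anabelioids.GaloisFiniteColimits

/-!
# The image anabelioid `I_φ ⊆ X` is closed under finite limits and colimits; its inclusion is exact

Mochizuki, *The geometry of anabelioids*, Publ. RIMS **40** (2004), §1.1 p. 14
[cite: MochizukiGeoAn2004, §1.1 p.14]: the image `I_φ` of a morphism `φ : X → Y` of connected
anabelioids (the full subcategory of `X` on the subquotients of objects `φ^* B`, Def. 1.1.7 (i)) "is a
connected anabelioid" and `φ` factors as `X → I_φ → Y`.  For the factor `X → I_φ` to be a MORPHISM of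
anabelioids in the tree's sense (`Anabelioids.Hom` = exact functor), the inclusion
`ι : I_φ ⥤ X` must preserve finite limits and finite colimits.  This proof-only file supplies that:

* `imageObj_of_epi'` — quotients of image objects are image objects (exported form);
* `isClosedUnderLimitsOfShape_imageObj`, `isClosedUnderColimitsOfShape_imageObj` — for every FINITE
  shape `J`: a finite limit is a subobject of the finite product (closed: abc-iut-L3-t9's
  `isClosedUnderFiniteProducts_imageObj`, `imageObj_of_mono'`), a finite colimit is a quotient of the
  finite coproduct (`isClosedUnderFiniteCoproducts_imageObj`); `X` has finite colimits by
  `hasFiniteColimits_of_galoisCategory`;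
* `preservesFiniteLimits_imageι`, `preservesFiniteColimits_imageι` — hence the inclusion creates,
  so preserves, finite (co)limits (Mathlib `createsLimitsOfShapeFullSubcategoryInclusion`).

Used for [SemiAnbd] Remark 2.3.1 (π₁-epimorphic approximators via image anabelioids; abc-iut row of
abc-iut-L6-d5). No definitions; classical category theory.
-/

namespace Literature.AnabelianGeometry.Anabelioids

open CategoryTheory CategoryTheory.Limits

universe v₁ v₂ u₁ u₂

variable {X : Type u₁} [Category.{v₁} X] {Y : Type u₂} [Category.{v₂} Y] [GaloisCategory X]
  [GaloisCategory Y] (φ : Hom X Y)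

omit [GaloisCategory X] [GaloisCategory Y] in
/-- Quotients of subquotients of objects `φ^* B` are again such (exported form of the stability of
`I_φ` under quotients). [cite: MochizukiGeoAn2004, Def. 1.1.7(i) p.14] -/
theorem imageObj_of_epi' {A A' : X} (g : A ⟶ A') [Epi g] (hA : imageObj φ.pullback A) :
    imageObj φ.pullback A' := by
  obtain ⟨B, S, i, q, hi, hq⟩ := hA
  exact ⟨B, S, i, q ≫ g, hi, epi_comp _ _⟩

/-- **`I_φ` is closed under finite limits in `X`**: a finite limit of image objects embeds (mono) into
their finite product. [cite: MochizukiGeoAn2004, §1.1 p.14] -/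
theorem isClosedUnderLimitsOfShape_imageObj (J : Type) [SmallCategory J] [FinCategory J] :
    (imageObj φ.pullback).IsClosedUnderLimitsOfShape J where
  limitsOfShape_le := by
    rintro A ⟨p⟩
    haveI := isClosedUnderFiniteProducts_imageObj φ
    have hprod : imageObj φ.pullback (∏ᶜ p.diag.obj) :=
      (imageObj φ.pullback).prop_limit (Discrete.functor p.diag.obj) fun ⟨j⟩ => p.prop_diag_obj j
    let m : A ⟶ ∏ᶜ p.diag.obj := Pi.lift fun j => p.π.app j
    haveI : Mono m := ⟨fun u v huv => p.isLimit.hom_ext fun j => by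
      have h := congrArg (· ≫ Pi.π p.diag.obj j) huv
      simp only [m, Category.assoc, Pi.lift_π] at h
      exact h⟩
    exact imageObj_of_mono' φ m hprod

/-- **`I_φ` is closed under finite colimits in `X`**: a finite colimit of image objects is a quotient
(epi) of their finite coproduct. [cite: MochizukiGeoAn2004, §1.1 p.14] -/
theorem isClosedUnderColimitsOfShape_imageObj (J : Type) [SmallCategory J] [FinCategory J] :
    (imageObj φ.pullback).IsClosedUnderColimitsOfShape J where
  colimitsOfShape_le := by
    rintro A ⟨p⟩
    haveI := isClosedUnderFiniteCoproducts_imageObj φ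
    have hcop : imageObj φ.pullback (∐ p.diag.obj) :=
      (imageObj φ.pullback).prop_colimit (Discrete.functor p.diag.obj) fun ⟨j⟩ => p.prop_diag_obj j
    let e : ∐ p.diag.obj ⟶ A := Sigma.desc fun j => p.ι.app j
    haveI : Epi e := ⟨fun u v huv => p.isColimit.hom_ext fun j => by
      have h := congrArg (Sigma.ι p.diag.obj j ≫ ·) huv
      simp only [e, Sigma.ι_desc_assoc] at h
      exact h⟩
    exact imageObj_of_epi' φ e hcop

/-- **The inclusion `ι : I_φ ⥤ X` preserves finite limits** (it creates them, `X` having them).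
[cite: MochizukiGeoAn2004, §1.1 p.14] -/
theorem preservesFiniteLimits_imageι : PreservesFiniteLimits (imageObj φ.pullback).ι := by
  refine ⟨fun J _ _ => ?_⟩
  haveI := isClosedUnderLimitsOfShape_imageObj φ J
  infer_instance

/-- **The inclusion `ι : I_φ ⥤ X` preserves finite colimits** (it creates them; `X` has finite
colimits, `hasFiniteColimits_of_galoisCategory`). [cite: MochizukiGeoAn2004, §1.1 p.14] -/
theorem preservesFiniteColimits_imageι : PreservesFiniteColimits (imageObj φ.pullback).ι := by
  refine ⟨fun J _ _ => ?_⟩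
  haveI := isClosedUnderColimitsOfShape_imageObj φ J
  haveI : HasColimitsOfShape J X := hasColimitsOfShape_of_galoisCategory X J
  infer_instance

end Literature.AnabelianGeometry.Anabelioids
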